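import Mathlib
import HarnessLib
import Literature.Analysis.Convex.LinearProgrammingDuality

/-!
# KKT optimality conditions for standard-form and alternative-form LP problems
# (Antoniou–Lu 2007, §11.2.1 (11.1)–(11.3), §11.2.2 Theorems 11.1–11.2, (11.5)–(11.8), Example 11.1)

Topic `Literature/Analysis/Convex`; namespace `Literature.Analysis.Convex.LPOptimalityConditions`.
Source: A. Antoniou, W.-S. Lu, *Practical Optimization: Algorithms and Engineering Applications*,
Springer (2007) [AL07] (bib `AntoniouLu2007`; held copy `book:antoniou2007-practical-optimization`
read — the held text is in 3000-character chunks, so the locators below are SECTION / EQUATION /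
THEOREM / EXAMPLE numbers, never page numbers), Ch. 11 "Linear programming Part I: the simplex
method", §11.2.1 "Formulation of LP problems" and §11.2.2 "Optimality conditions".
Everything below is PROVED (no `sorry`, no named facts).  The statements are made over an
arbitrary linearly ordered field `𝕜` (the book works over `ℝ`; nothing in §11.2.2 uses more than
ordered-field arithmetic and LP duality, which the tree provides over `𝕜`).

Setting [AL07 §11.2.1]: the STANDARD-FORM LP problem (11.1) `minimize f(x) = cᵀx subject to
Ax = b, x ≥ 0`, `A ∈ ℝ^{p×n}`, and the ALTERNATIVE-FORM LP problem (11.2) `minimize cᵀx subject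
to Ax ≥ b` (rows `aᵢᵀx ≥ bᵢ`, `1 ≤ i ≤ p`).  Vectors are `n → 𝕜` / `p → 𝕜`; the book's `λ` is
written `lam`; `Aᵀλ` is `Aᵀ *ᵥ lam`.

## What is formalised

* `StdFeasible`, `StdOptimal`, `AltFeasible`, `AltOptimal` — (11.1b,c), (11.2b) and "global
  solution" of (11.1) / (11.2); `StdKKT` — conditions (11.5a)–(11.5d); `AltKKT` — (11.8a)–(11.8c).
* **Theorem 11.1** (`stdOptimal_iff_kkt`; the two directions `stdOptimal_of_kkt`,
  `exists_stdKKT_of_optimal`): `x*` is a global solution of (11.1) iff (11.5) holds for some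
  `λ* ∈ ℝᵖ`, `μ* ≥ 0`.  The book derives it from the general KKT theorems 10.2/10.8 and therefore
  carries the hypothesis "`x*` regular for the active constraints"; for LINEAR constraints no
  constraint qualification is needed, and the Lean statement has none: necessity is obtained from
  the affine form of Farkas' lemma / LP duality already in the tree
  (`LPDuality.affine_farkas` of `LinearProgrammingDuality`, Schrijver 1986 Cor. 7.1h — imported,
  not restated),
  applied to the system `[A; −A; −I]x ≤ (b; −b; 0)` and the valid inequality `−cᵀx ≤ −cᵀx*`.
* **Theorem 11.2** (`altOptimal_iff_kkt`; `altOptimal_of_kkt`, `exists_altKKT_of_optimal`): the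
  same for (11.2) with (11.8), again without the regularity hypothesis (Farkas for `−Ax ≤ −b`).
* (11.6) and the discussion after Theorem 11.1: at a STRICTLY feasible solution (`xᵢ* > 0` for all
  `i`) complementarity forces `μ* = 0`, so `c = Aᵀλ*` (`mu_eq_zero_of_strictlyFeasible`,
  `c_eq_transpose_mulVec_of_interior_solution`), and then `f` is CONSTANT on the feasible region,
  `f(x) = λ*ᵀb` (`objective_const_of_c_eq`, `objective_const_of_interior_solution` — the situation
  of Fig. 11.2); contrapositively, if `c` is not of the form `Aᵀλ` no strictly feasible point is a
  solution (`not_optimal_of_interior`, the argument of Example 11.1).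
* The discussion after Theorem 11.2: a solution of (11.2) with `Ax* > b` forces `μ* = 0` and hence
  `c = 0` (`c_eq_zero_of_strict_alt_solution`) — "any solutions … can only occur on the boundary".
* (11.3): the conversion of (11.2) into standard form with `x̂ = (x⁺; x⁻; y)`, `ĉ = (c; −c; 0)`,
  `Â = [A −A −I_p]` (`hatA`, `hatC`, `hatX`): `Â x̂ = A(x⁺ − x⁻) − y` and `ĉᵀx̂ = cᵀ(x⁺ − x⁻)`
  (`hatA_mulVec`, `hatC_dotProduct`), feasibility and objective are preserved in both directions
  (`stdFeasible_hatX`, `hatC_dotProduct_hatX`, `altFeasible_of_stdFeasible_hat`) and `x` solves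
  (11.2) iff `x̂` solves (11.3) (`altOptimal_iff_hatOptimal`).
* Example 11.1 (`example_11_1_kkt`, `example_11_1_optimal`): for `f = x₁ + 4x₂`, `x₁ + x₂ = 1`,
  `x ≥ 0` the point `x* = (1, 0)ᵀ` with `λ* = 1`, `μ* = (0, 3)ᵀ` satisfies (11.5), hence is a global
  solution (over `ℚ`, by computation + Theorem 11.1).

Relation to the tree: `PhaseOneArtificialVariables.StdFeasible` (Luenberger–Ye §3.5, over `ℝ`,
pointwise `∀ j, 0 ≤ x j`) is the `𝕜 = ℝ` reading of `StdFeasible` below; the LP duality /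
Farkas machinery is `LinearProgrammingDuality` (`LPDuality.*`, imported and USED); the vertex
theory of §11.2.3–§11.2.4 is `LPVertexFinding`; the KKT system (11.5) reappears as the mixed LCP
(13.54) in `ConvexQPPathFollowing`.  None of these states Theorems 11.1/11.2.

NOT formalised: the geometry of §11.2.3 (facets, edges, vertices — see the tree's
`LPVertexFinding` for §11.2.3.2–§11.2.4), Figs. 11.1–11.2, Example 11.2 (numerical), the general
form (11.4).
-/

namespace Literature.Analysis.Convex.LPOptimalityConditions

open Matrix

variable {𝕜 : Type*} [Field 𝕜] [LinearOrder 𝕜] [IsStrictOrderedRing 𝕜]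
variable {n p : Type*} [Fintype n] [Fintype p]

/-! ### §11.2.1: the standard-form problem (11.1) and the alternative-form problem (11.2) -/

/-- Feasibility for the standard-form LP problem (11.1): `Ax = b` (11.1b) and `x ≥ 0` (11.1c).
[cite: AntoniouLu2007, §11.2.1 (11.1b)-(11.1c)] -/
def StdFeasible (A : Matrix p n 𝕜) (b : p → 𝕜) (x : n → 𝕜) : Prop :=
  A *ᵥ x = b ∧ 0 ≤ x

/-- `x*` is a (global) solution of the standard-form LP problem (11.1): feasible, and
`cᵀx* ≤ cᵀx` for every feasible `x`. [cite: AntoniouLu2007, §11.2.1 (11.1)] -/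
def StdOptimal (A : Matrix p n 𝕜) (b : p → 𝕜) (c : n → 𝕜) (xs : n → 𝕜) : Prop :=
  StdFeasible A b xs ∧ ∀ x, StdFeasible A b x → c ⬝ᵥ xs ≤ c ⬝ᵥ x

/-- Feasibility for the alternative-form LP problem (11.2): `Ax ≥ b` (11.2b), i.e. `aᵢᵀx ≥ bᵢ`
for `1 ≤ i ≤ p`. [cite: AntoniouLu2007, §11.2.1 (11.2b)] -/
def AltFeasible (A : Matrix p n 𝕜) (b : p → 𝕜) (x : n → 𝕜) : Prop :=
  b ≤ A *ᵥ x

/-- `x*` is a (global) solution of the alternative-form LP problem (11.2).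
[cite: AntoniouLu2007, §11.2.1 (11.2)] -/
def AltOptimal (A : Matrix p n 𝕜) (b : p → 𝕜) (c : n → 𝕜) (xs : n → 𝕜) : Prop :=
  AltFeasible A b xs ∧ ∀ x, AltFeasible A b x → c ⬝ᵥ xs ≤ c ⬝ᵥ x

/-- The Karush–Kuhn–Tucker conditions (11.5) of Theorem 11.1: (a) `Ax* = b`, (b) `x* ≥ 0`,
(c) `μ* ≥ 0` and `c = Aᵀλ* + μ*`, (d) `μᵢ* xᵢ* = 0` for `1 ≤ i ≤ n`.
[cite: AntoniouLu2007, §11.2.2 Theorem 11.1 (11.5a)-(11.5d)] -/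
def StdKKT (A : Matrix p n 𝕜) (b : p → 𝕜) (c : n → 𝕜) (xs : n → 𝕜) (lam : p → 𝕜)
    (mu : n → 𝕜) : Prop :=
  A *ᵥ xs = b ∧ 0 ≤ xs ∧ 0 ≤ mu ∧ c = Aᵀ *ᵥ lam + mu ∧ ∀ i, mu i * xs i = 0

/-- The conditions (11.8) of Theorem 11.2: (a) `Ax* ≥ b`, (b) `μ* ≥ 0` and `c = Aᵀμ*`,
(c) `μᵢ*(aᵢᵀx* − bᵢ) = 0` for `1 ≤ i ≤ p`.
[cite: AntoniouLu2007, §11.2.2 Theorem 11.2 (11.8a)-(11.8c)] -/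
def AltKKT (A : Matrix p n 𝕜) (b : p → 𝕜) (c : n → 𝕜) (xs : n → 𝕜) (mu : p → 𝕜) : Prop :=
  b ≤ A *ᵥ xs ∧ 0 ≤ mu ∧ c = Aᵀ *ᵥ mu ∧ ∀ i, mu i * ((A *ᵥ xs) i - b i) = 0

omit [LinearOrder 𝕜] [IsStrictOrderedRing 𝕜] in
/-- The Lagrangian identity behind (11.5c): `(Aᵀλ + μ)ᵀx = λᵀ(Ax) + μᵀx`. [folklore] -/
private theorem kkt_dotProduct (A : Matrix p n 𝕜) (lam : p → 𝕜) (mu x : n → 𝕜) :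
    (Aᵀ *ᵥ lam + mu) ⬝ᵥ x = lam ⬝ᵥ (A *ᵥ x) + mu ⬝ᵥ x := by
  rw [add_dotProduct, mulVec_transpose, dotProduct_mulVec]

/-- A sum of nonnegative products that is `≤ 0` has every product zero. [folklore] -/
private theorem mul_eq_zero_of_sum_nonpos {ι : Type*} [Fintype ι] {u v : ι → 𝕜} (hu : 0 ≤ u)
    (hv : 0 ≤ v) (h : u ⬝ᵥ v ≤ 0) (i : ι) : u i * v i = 0 := by
  have hnn : ∀ j ∈ Finset.univ, 0 ≤ u j * v j := fun j _ => mul_nonneg (hu j) (hv j)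
  have hsum : ∑ j, u j * v j = 0 := le_antisymm h (Finset.sum_nonneg hnn)
  exact (Finset.sum_eq_zero_iff_of_nonneg hnn).1 hsum i (Finset.mem_univ i)

/-! ### §11.2.2, Theorem 11.1 (standard form) -/

omit [IsStrictOrderedRing 𝕜] in
/-- Sufficiency in Theorem 11.1, with the value: if `{x*, λ*, μ*}` satisfies (11.5) then
`cᵀx* = λ*ᵀb` (from (11.5c) and (11.5d): `cᵀx* = λ*ᵀAx* + μ*ᵀx* = λ*ᵀb`).
[cite: AntoniouLu2007, §11.2.2 Theorem 11.1 (11.5)] -/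
theorem objective_eq_of_stdKKT {A : Matrix p n 𝕜} {b : p → 𝕜} {c : n → 𝕜} {xs : n → 𝕜}
    {lam : p → 𝕜} {mu : n → 𝕜} (h : StdKKT A b c xs lam mu) : c ⬝ᵥ xs = lam ⬝ᵥ b := by
  obtain ⟨hA, -, -, hc, hcs⟩ := h
  have hmu : mu ⬝ᵥ xs = 0 := Finset.sum_eq_zero fun i _ => hcs i
  rw [hc, kkt_dotProduct, hA, hmu, add_zero]

/-- Weak duality behind Theorem 11.1: if `c = Aᵀλ + μ` with `μ ≥ 0` then `λᵀb ≤ cᵀx` for every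
feasible `x` of (11.1) (`cᵀx = λᵀAx + μᵀx ≥ λᵀb`). [cite: AntoniouLu2007, §11.2.2 Theorem 11.1 (11.5c)] -/
theorem lam_dotProduct_le_of_stdFeasible {A : Matrix p n 𝕜} {b : p → 𝕜} {c : n → 𝕜}
    {lam : p → 𝕜} {mu : n → 𝕜} (hmu : 0 ≤ mu) (hc : c = Aᵀ *ᵥ lam + mu) {x : n → 𝕜}
    (hx : StdFeasible A b x) : lam ⬝ᵥ b ≤ c ⬝ᵥ x := by
  obtain ⟨hA, hx0⟩ := hx
  have hnn : 0 ≤ mu ⬝ᵥ x := Finset.sum_nonneg fun i _ => mul_nonneg (hmu i) (hx0 i)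
  rw [hc, kkt_dotProduct, hA]
  linarith

/-- **Theorem 11.1, sufficiency ("if"):** a point satisfying the KKT conditions (11.5) is a global
solution of the standard-form LP problem (11.1).
[cite: AntoniouLu2007, §11.2.2 Theorem 11.1] -/
theorem stdOptimal_of_kkt {A : Matrix p n 𝕜} {b : p → 𝕜} {c : n → 𝕜} {xs : n → 𝕜}
    {lam : p → 𝕜} {mu : n → 𝕜} (h : StdKKT A b c xs lam mu) : StdOptimal A b c xs := by
  refine ⟨⟨h.1, h.2.1⟩, fun x hx => ?_⟩
  rw [objective_eq_of_stdKKT h]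
  exact lam_dotProduct_le_of_stdFeasible h.2.2.1 h.2.2.2.1 hx

omit [Fintype p] in
/-- The standard-form feasible region written as ONE system of inequalities
`[A; −A; −I]x ≤ (b; −b; 0)` (the form to which Farkas' lemma applies). [folklore] -/
private theorem stdBlock_le_iff [DecidableEq n] (A : Matrix p n 𝕜) (b : p → 𝕜) (x : n → 𝕜) :
    fromRows (fromRows A (-A)) (-(1 : Matrix n n 𝕜)) *ᵥ x ≤ Sum.elim (Sum.elim b (-b)) 0 ↔
      StdFeasible A b x := by
  rw [fromRows_mulVec, fromRows_mulVec, neg_mulVec, neg_mulVec, one_mulVec,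
    Sum.elim_le_elim_iff, Sum.elim_le_elim_iff, neg_le_neg_iff, neg_nonpos]
  constructor
  · rintro ⟨⟨h1, h2⟩, h3⟩
    exact ⟨le_antisymm h1 h2, h3⟩
  · rintro ⟨h, h3⟩
    exact ⟨⟨h.le, h.ge⟩, h3⟩

/-- **Theorem 11.1, necessity ("only if"), without any regularity hypothesis:** if `x*` is a
global solution of (11.1) then there exist Lagrange multipliers `λ* ∈ ℝᵖ` and `μ* ≥ 0` with
`c = Aᵀλ* + μ*` (11.5c) and `μᵢ* xᵢ* = 0` (11.5d).  Proof: the inequality `−cᵀx ≤ −cᵀx*` is valid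
on `{x | [A; −A; −I]x ≤ (b; −b; 0)}`, so by the affine form of Farkas' lemma (tree:
`LPDuality.affine_farkas`) it is a nonnegative combination `(y₁; y₂; z) ≥ 0` of the
rows: `y₁A − y₂A − z = −c` and `y₁b − y₂b ≤ −cᵀx*`; put `λ* = y₂ − y₁`, `μ* = z`; then
`μ*ᵀx* = cᵀx* − λ*ᵀb ≤ 0` forces (11.5d). [cite: AntoniouLu2007, §11.2.2 Theorem 11.1] -/
theorem exists_stdKKT_of_optimal {A : Matrix p n 𝕜} {b : p → 𝕜} {c : n → 𝕜} {xs : n → 𝕜}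
    (h : StdOptimal A b c xs) : ∃ (lam : p → 𝕜) (mu : n → 𝕜), StdKKT A b c xs lam mu := by
  classical
  obtain ⟨hxs, hopt⟩ := h
  set M : Matrix ((p ⊕ p) ⊕ n) n 𝕜 := fromRows (fromRows A (-A)) (-(1 : Matrix n n 𝕜)) with hM
  set b' : (p ⊕ p) ⊕ n → 𝕜 := Sum.elim (Sum.elim b (-b)) 0 with hb'
  have hP : ∃ x : n → 𝕜, M *ᵥ x ≤ b' := ⟨xs, (stdBlock_le_iff A b xs).2 hxs⟩
  have hδ : ∀ x : n → 𝕜, M *ᵥ x ≤ b' → (-c) ⬝ᵥ x ≤ -(c ⬝ᵥ xs) := by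
    intro x hx
    rw [neg_dotProduct, neg_le_neg_iff]
    exact hopt x ((stdBlock_le_iff A b x).1 hx)
  obtain ⟨y, hy, hyM, hyb⟩ := LPDuality.affine_farkas M b' (-c) hP hδ
  -- split the multiplier vector into its three blocks
  set y₁ : p → 𝕜 := fun i => y (Sum.inl (Sum.inl i)) with hy₁
  set y₂ : p → 𝕜 := fun i => y (Sum.inl (Sum.inr i)) with hy₂
  set z : n → 𝕜 := fun j => y (Sum.inr j) with hz
  have hy_eq : y = Sum.elim (Sum.elim y₁ y₂) z := by
    ext ((i | i) | j) <;> rfl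
  rw [hy_eq, hM, sumElim_vecMul_fromRows, sumElim_vecMul_fromRows, vecMul_neg, vecMul_neg,
    vecMul_one] at hyM
  rw [hy_eq, hb', sumElim_dotProduct_sumElim, sumElim_dotProduct_sumElim, dotProduct_neg,
    dotProduct_zero, add_zero] at hyb
  refine ⟨y₂ - y₁, z, hxs.1, hxs.2, fun j => hy (Sum.inr j), ?_, ?_⟩
  · -- (11.5c): `c = Aᵀ(y₂ − y₁) + z`
    rw [mulVec_transpose, sub_vecMul]
    have : c = -(y₁ ᵥ* A + -(y₂ ᵥ* A) + -z) := by rw [hyM, neg_neg]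
    rw [this]
    abel
  · -- (11.5d): `zᵀx* = cᵀx* − (y₂ − y₁)ᵀb ≤ 0` with nonnegative terms
    have hc : c = Aᵀ *ᵥ (y₂ - y₁) + z := by
      rw [mulVec_transpose, sub_vecMul]
      have : c = -(y₁ ᵥ* A + -(y₂ ᵥ* A) + -z) := by rw [hyM, neg_neg]
      rw [this]
      abel
    have hval : c ⬝ᵥ xs = (y₂ - y₁) ⬝ᵥ b + z ⬝ᵥ xs := by
      rw [hc, kkt_dotProduct, hxs.1]
    have hzx : z ⬝ᵥ xs ≤ 0 := by
      rw [sub_dotProduct] at hval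
      linarith
    exact mul_eq_zero_of_sum_nonpos (fun j => hy (Sum.inr j)) hxs.2 hzx

/-- **AL07 Theorem 11.1 (Karush–Kuhn–Tucker conditions for the standard-form LP problem):**
`x*` is a global solution of (11.1) if and only if (11.5a)–(11.5d) hold for some `λ* ∈ ℝᵖ`,
`μ* ∈ ℝⁿ`.  (The printed hypothesis "`x*` regular for the constraints active at `x*`" is not
needed for linear constraints and is dropped.) [cite: AntoniouLu2007, §11.2.2 Theorem 11.1] -/
theorem stdOptimal_iff_kkt (A : Matrix p n 𝕜) (b : p → 𝕜) (c : n → 𝕜) (xs : n → 𝕜) :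
    StdOptimal A b c xs ↔ ∃ (lam : p → 𝕜) (mu : n → 𝕜), StdKKT A b c xs lam mu :=
  ⟨exists_stdKKT_of_optimal, fun ⟨_, _, h⟩ => stdOptimal_of_kkt h⟩

/-! ### (11.6): strictly feasible solutions -/

/-- From (11.5d): at a STRICTLY feasible point (`xᵢ* > 0` for all `i`) the multiplier `μ*` must be
the zero vector, so (11.5c) becomes (11.6) `c = Aᵀλ*`.
[cite: AntoniouLu2007, §11.2.2 (11.5d), (11.6)] -/
theorem mu_eq_zero_of_strictlyFeasible {A : Matrix p n 𝕜} {b : p → 𝕜} {c : n → 𝕜} {xs : n → 𝕜}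
    {lam : p → 𝕜} {mu : n → 𝕜} (h : StdKKT A b c xs lam mu) (hpos : ∀ i, 0 < xs i) :
    mu = 0 ∧ c = Aᵀ *ᵥ lam := by
  have hmu : mu = 0 := by
    funext i
    have := h.2.2.2.2 i
    rcases mul_eq_zero.1 this with h0 | h0
    · exact h0
    · exact absurd h0 (hpos i).ne'
  refine ⟨hmu, ?_⟩
  have hc := h.2.2.2.1
  rwa [hmu, add_zero] at hc

/-- (11.6) at a solution: if a strictly feasible `x*` is a global solution of (11.1) then `c` lies
in the range of `Aᵀ`, `c = Aᵀλ*` for some `λ*`. [cite: AntoniouLu2007, §11.2.2 (11.6)] -/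
theorem c_eq_transpose_mulVec_of_interior_solution {A : Matrix p n 𝕜} {b : p → 𝕜} {c : n → 𝕜}
    {xs : n → 𝕜} (h : StdOptimal A b c xs) (hpos : ∀ i, 0 < xs i) :
    ∃ lam : p → 𝕜, c = Aᵀ *ᵥ lam := by
  obtain ⟨lam, mu, hk⟩ := exists_stdKKT_of_optimal h
  exact ⟨lam, (mu_eq_zero_of_strictlyFeasible hk hpos).2⟩

omit [IsStrictOrderedRing 𝕜] in
/-- If (11.6) `c = Aᵀλ*` holds then the objective is CONSTANT on the feasible region of (11.1):
`f(x) = λ*ᵀAx = λ*ᵀb` — "any feasible point becomes a global solution" (the situation of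
Fig. 11.2, `f(x) = 4(x₁ + x₂) = 4`). [cite: AntoniouLu2007, §11.2.2 (11.6), Example 11.1] -/
theorem objective_const_of_c_eq {A : Matrix p n 𝕜} {b : p → 𝕜} {c : n → 𝕜} {lam : p → 𝕜}
    (hc : c = Aᵀ *ᵥ lam) {x : n → 𝕜} (hx : StdFeasible A b x) : c ⬝ᵥ x = lam ⬝ᵥ b := by
  rw [hc, mulVec_transpose, ← dotProduct_mulVec, hx.1]

omit [IsStrictOrderedRing 𝕜] in
/-- With (11.6), every feasible point is a global solution of (11.1).
[cite: AntoniouLu2007, §11.2.2 (11.6), Example 11.1] -/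
theorem stdOptimal_of_c_eq {A : Matrix p n 𝕜} {b : p → 𝕜} {c : n → 𝕜} {lam : p → 𝕜}
    (hc : c = Aᵀ *ᵥ lam) {xs : n → 𝕜} (hxs : StdFeasible A b xs) : StdOptimal A b c xs :=
  ⟨hxs, fun x hx => by rw [objective_const_of_c_eq hc hxs, objective_const_of_c_eq hc hx]⟩

/-- Consequently a strictly feasible point can be a solution only when `f` is constant on the
whole feasible region: if `x* > 0` solves (11.1) then `f(x) = f(x*)` for every feasible `x`.
[cite: AntoniouLu2007, §11.2.2 (11.6)] -/
theorem objective_const_of_interior_solution {A : Matrix p n 𝕜} {b : p → 𝕜} {c : n → 𝕜}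
    {xs : n → 𝕜} (h : StdOptimal A b c xs) (hpos : ∀ i, 0 < xs i) {x : n → 𝕜}
    (hx : StdFeasible A b x) : c ⬝ᵥ x = c ⬝ᵥ xs := by
  obtain ⟨lam, hc⟩ := c_eq_transpose_mulVec_of_interior_solution h hpos
  rw [objective_const_of_c_eq hc hx, objective_const_of_c_eq hc h.1]

/-- The argument of Example 11.1: if `c` is NOT of the form `Aᵀλ` ("`c` and `Aᵀ` are linearly
independent, Eq. (11.6) cannot be satisfied") then no strictly feasible (interior) point is a
solution — the solutions lie on the boundary of the feasible region.
[cite: AntoniouLu2007, §11.2.2 (11.6), Example 11.1] -/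
theorem not_optimal_of_interior {A : Matrix p n 𝕜} {b : p → 𝕜} {c : n → 𝕜}
    (hc : ∀ lam : p → 𝕜, c ≠ Aᵀ *ᵥ lam) {xs : n → 𝕜} (hpos : ∀ i, 0 < xs i) :
    ¬ StdOptimal A b c xs := by
  intro h
  obtain ⟨lam, h'⟩ := c_eq_transpose_mulVec_of_interior_solution h hpos
  exact hc lam h'

/-! ### §11.2.2, Theorem 11.2 (alternative form) -/

omit [IsStrictOrderedRing 𝕜] in
/-- Sufficiency in Theorem 11.2, with the value: (11.8) gives `cᵀx* = μ*ᵀAx* = μ*ᵀb` (by (11.8c)).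
[cite: AntoniouLu2007, §11.2.2 Theorem 11.2 (11.8)] -/
theorem objective_eq_of_altKKT {A : Matrix p n 𝕜} {b : p → 𝕜} {c : n → 𝕜} {xs : n → 𝕜}
    {mu : p → 𝕜} (h : AltKKT A b c xs mu) : c ⬝ᵥ xs = mu ⬝ᵥ b := by
  obtain ⟨-, -, hc, hcs⟩ := h
  have hsum : mu ⬝ᵥ (A *ᵥ xs - b) = 0 := Finset.sum_eq_zero fun i _ => hcs i
  rw [dotProduct_sub, sub_eq_zero] at hsum
  rw [hc, mulVec_transpose, ← dotProduct_mulVec, hsum]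

/-- Weak duality behind Theorem 11.2: if `c = Aᵀμ` with `μ ≥ 0` then `μᵀb ≤ μᵀAx = cᵀx` for every
`x` with `Ax ≥ b`. [cite: AntoniouLu2007, §11.2.2 Theorem 11.2 (11.8b)] -/
theorem mu_dotProduct_le_of_altFeasible {A : Matrix p n 𝕜} {b : p → 𝕜} {c : n → 𝕜}
    {mu : p → 𝕜} (hmu : 0 ≤ mu) (hc : c = Aᵀ *ᵥ mu) {x : n → 𝕜} (hx : AltFeasible A b x) :
    mu ⬝ᵥ b ≤ c ⬝ᵥ x := by
  rw [hc, mulVec_transpose, ← dotProduct_mulVec]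
  exact dotProduct_le_dotProduct_of_nonneg_left hx hmu

/-- **Theorem 11.2, sufficiency:** a point satisfying (11.8) is a global solution of (11.2).
[cite: AntoniouLu2007, §11.2.2 Theorem 11.2] -/
theorem altOptimal_of_kkt {A : Matrix p n 𝕜} {b : p → 𝕜} {c : n → 𝕜} {xs : n → 𝕜}
    {mu : p → 𝕜} (h : AltKKT A b c xs mu) : AltOptimal A b c xs := by
  refine ⟨h.1, fun x hx => ?_⟩
  rw [objective_eq_of_altKKT h]
  exact mu_dotProduct_le_of_altFeasible h.2.1 h.2.2.1 hx

/-- **Theorem 11.2, necessity, without any regularity hypothesis:** a global solution `x*` of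
(11.2) admits `μ* ≥ 0` with `c = Aᵀμ*` and `μᵢ*(aᵢᵀx* − bᵢ) = 0`.  Proof: `−cᵀx ≤ −cᵀx*` is valid
on `{x | −Ax ≤ −b}`, so (tree `affine_farkas`) some `y ≥ 0` has `y(−A) = −c`, `y(−b) ≤ −cᵀx*`;
then `μ* = y` and `μ*ᵀ(Ax* − b) = cᵀx* − μ*ᵀb ≤ 0` with nonnegative terms.
[cite: AntoniouLu2007, §11.2.2 Theorem 11.2] -/
theorem exists_altKKT_of_optimal {A : Matrix p n 𝕜} {b : p → 𝕜} {c : n → 𝕜} {xs : n → 𝕜}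
    (h : AltOptimal A b c xs) : ∃ mu : p → 𝕜, AltKKT A b c xs mu := by
  obtain ⟨hxs, hopt⟩ := h
  have hfeas : ∀ x : n → 𝕜, (-A) *ᵥ x ≤ -b ↔ AltFeasible A b x := fun x => by
    rw [neg_mulVec, neg_le_neg_iff]; rfl
  have hP : ∃ x : n → 𝕜, (-A) *ᵥ x ≤ -b := ⟨xs, (hfeas xs).2 hxs⟩
  have hδ : ∀ x : n → 𝕜, (-A) *ᵥ x ≤ -b → (-c) ⬝ᵥ x ≤ -(c ⬝ᵥ xs) := by
    intro x hx
    rw [neg_dotProduct, neg_le_neg_iff]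
    exact hopt x ((hfeas x).1 hx)
  obtain ⟨y, hy, hyA, hyb⟩ := LPDuality.affine_farkas (-A) (-b) (-c) hP hδ
  rw [vecMul_neg, neg_inj] at hyA
  rw [dotProduct_neg, neg_le_neg_iff] at hyb
  have hc : c = Aᵀ *ᵥ y := by rw [mulVec_transpose, hyA]
  refine ⟨y, hxs, hy, hc, ?_⟩
  have hval : c ⬝ᵥ xs = y ⬝ᵥ (A *ᵥ xs) := by rw [hc, mulVec_transpose, ← dotProduct_mulVec]
  have hle : y ⬝ᵥ (A *ᵥ xs - b) ≤ 0 := by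
    rw [dotProduct_sub]
    linarith
  exact mul_eq_zero_of_sum_nonpos hy (fun i => sub_nonneg.2 (hxs i)) hle

/-- **AL07 Theorem 11.2 (necessary and sufficient conditions for a minimum in the alternative-form
LP problem):** `x*` is a global solution of (11.2) if and only if (11.8a)–(11.8c) hold for some
`μ* ∈ ℝᵖ` (regularity hypothesis dropped, as for Theorem 11.1).
[cite: AntoniouLu2007, §11.2.2 Theorem 11.2] -/
theorem altOptimal_iff_kkt (A : Matrix p n 𝕜) (b : p → 𝕜) (c : n → 𝕜) (xs : n → 𝕜) :
    AltOptimal A b c xs ↔ ∃ mu : p → 𝕜, AltKKT A b c xs mu :=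
  ⟨exists_altKKT_of_optimal, fun ⟨_, h⟩ => altOptimal_of_kkt h⟩

/-- At a point with `Ax* > b` (every constraint inactive) the complementarity condition (11.8c)
forces `μ* = 0`. [cite: AntoniouLu2007, §11.2.2 Theorem 11.2 (11.8c)] -/
theorem altMu_eq_zero_of_strict {A : Matrix p n 𝕜} {b : p → 𝕜} {c : n → 𝕜} {xs : n → 𝕜}
    {mu : p → 𝕜} (h : AltKKT A b c xs mu) (hstrict : ∀ i, b i < (A *ᵥ xs) i) : mu = 0 := by
  funext i
  rcases mul_eq_zero.1 (h.2.2.2 i) with h0 | h0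
  · exact h0
  · exact absurd (sub_eq_zero.1 h0) (hstrict i).ne'

/-- The remark after Theorem 11.2: if a strictly feasible point (`Ax* > b`) is a solution of (11.2)
then `μ* = 0` and (11.8b) gives `c = 0` ("a meaningless LP problem") — so the solutions of (11.2)
can only occur on the boundary of the feasible region.
[cite: AntoniouLu2007, §11.2.2 Theorem 11.2 (11.8b)-(11.8c)] -/
theorem c_eq_zero_of_strict_alt_solution {A : Matrix p n 𝕜} {b : p → 𝕜} {c : n → 𝕜}
    {xs : n → 𝕜} (h : AltOptimal A b c xs) (hstrict : ∀ i, b i < (A *ᵥ xs) i) : c = 0 := by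
  obtain ⟨mu, hk⟩ := exists_altKKT_of_optimal h
  rw [hk.2.2.1, altMu_eq_zero_of_strict hk hstrict, mulVec_zero]

/-- Contrapositive: for `c ≠ 0` no point with `Ax > b` solves (11.2).
[cite: AntoniouLu2007, §11.2.2 Theorem 11.2] -/
theorem not_altOptimal_of_strict {A : Matrix p n 𝕜} {b : p → 𝕜} {c : n → 𝕜} (hc : c ≠ 0)
    {xs : n → 𝕜} (hstrict : ∀ i, b i < (A *ᵥ xs) i) : ¬ AltOptimal A b c xs :=
  fun h => hc (c_eq_zero_of_strict_alt_solution h hstrict)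

/-! ### (11.3): the alternative-form problem as a standard-form problem -/

/-- `Â = [A −A −I_p]` of (11.3). [cite: AntoniouLu2007, §11.2.1 (11.3)] -/
def hatA [DecidableEq p] (A : Matrix p n 𝕜) : Matrix p ((n ⊕ n) ⊕ p) 𝕜 :=
  fromCols (fromCols A (-A)) (-(1 : Matrix p p 𝕜))

/-- `ĉ = (c; −c; 0)` of (11.3). [cite: AntoniouLu2007, §11.2.1 (11.3)] -/
def hatC (c : n → 𝕜) : (n ⊕ n) ⊕ p → 𝕜 :=
  Sum.elim (Sum.elim c (-c)) 0

/-- `x̂ = (x⁺; x⁻; y)` with `x = x⁺ − x⁻`, `x⁺, x⁻ ≥ 0` and the slack vector `y = Ax − b`.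
[cite: AntoniouLu2007, §11.2.1 (11.3)] -/
def hatX (A : Matrix p n 𝕜) (b : p → 𝕜) (x : n → 𝕜) : (n ⊕ n) ⊕ p → 𝕜 :=
  Sum.elim (Sum.elim x⁺ x⁻) (A *ᵥ x - b)

omit [LinearOrder 𝕜] [IsStrictOrderedRing 𝕜] in
/-- `Â (u; v; y) = A(u − v) − y`. [cite: AntoniouLu2007, §11.2.1 (11.3b)] -/
theorem hatA_mulVec [DecidableEq p] (A : Matrix p n 𝕜) (u v : n → 𝕜) (y : p → 𝕜) :
    hatA A *ᵥ Sum.elim (Sum.elim u v) y = A *ᵥ (u - v) - y := by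
  rw [hatA, fromCols_mulVec_sumElim, fromCols_mulVec_sumElim, neg_mulVec, neg_mulVec, one_mulVec,
    mulVec_sub]
  abel

omit [LinearOrder 𝕜] [IsStrictOrderedRing 𝕜] in
/-- `ĉᵀ(u; v; y) = cᵀ(u − v)`. [cite: AntoniouLu2007, §11.2.1 (11.3a)] -/
theorem hatC_dotProduct (c u v : n → 𝕜) (y : p → 𝕜) :
    hatC (p := p) c ⬝ᵥ Sum.elim (Sum.elim u v) y = c ⬝ᵥ (u - v) := by
  rw [hatC, sumElim_dotProduct_sumElim, sumElim_dotProduct_sumElim, neg_dotProduct, zero_dotProduct,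
    dotProduct_sub]
  abel

omit [Field 𝕜] [LinearOrder 𝕜] [IsStrictOrderedRing 𝕜] [Fintype n] [Fintype p] in
/-- Every vector of the augmented space is a block vector `(u; v; y)`. [folklore] -/
private theorem sumElim_blocks (w : (n ⊕ n) ⊕ p → 𝕜) :
    w = Sum.elim (Sum.elim (fun j => w (Sum.inl (Sum.inl j))) (fun j => w (Sum.inl (Sum.inr j))))
      (fun i => w (Sum.inr i)) := by
  ext ((j | j) | i) <;> rfl

/-- If `Ax ≥ b` then `x̂ = (x⁺; x⁻; Ax − b)` is feasible for the standard-form problem (11.3):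
`x̂ ≥ 0` and `Â x̂ = A(x⁺ − x⁻) − (Ax − b) = b`. [cite: AntoniouLu2007, §11.2.1 (11.3b)-(11.3c)] -/
theorem stdFeasible_hatX [DecidableEq p] {A : Matrix p n 𝕜} {b : p → 𝕜} {x : n → 𝕜} (hx : AltFeasible A b x) :
    StdFeasible (hatA A) b (hatX A b x) := by
  refine ⟨?_, ?_⟩
  · rw [hatX, hatA_mulVec, posPart_sub_negPart]
    abel
  · rw [hatX]
    rintro ((j | j) | i)
    · exact posPart_nonneg _
    · exact negPart_nonneg _
    · exact sub_nonneg.2 (hx i)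

/-- The objective is preserved: `ĉᵀx̂ = cᵀ(x⁺ − x⁻) = cᵀx`. [cite: AntoniouLu2007, §11.2.1 (11.3a)] -/
theorem hatC_dotProduct_hatX (A : Matrix p n 𝕜) (b : p → 𝕜) (c x : n → 𝕜) :
    hatC c ⬝ᵥ hatX A b x = c ⬝ᵥ x := by
  rw [hatX, hatC_dotProduct, posPart_sub_negPart]

/-- Conversely a feasible point `(u; v; y)` of (11.3) gives the feasible point `x = u − v` of (11.2)
(`A(u − v) = b + y ≥ b`) with the same objective value `ĉᵀ(u; v; y) = cᵀ(u − v)`.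
[cite: AntoniouLu2007, §11.2.1 (11.3)] -/
theorem altFeasible_of_stdFeasible_hat [DecidableEq p] {A : Matrix p n 𝕜} {b : p → 𝕜} {u v : n → 𝕜}
    {y : p → 𝕜} (h : StdFeasible (hatA A) b (Sum.elim (Sum.elim u v) y)) :
    AltFeasible A b (u - v) := by
  obtain ⟨hA, h0⟩ := h
  rw [hatA_mulVec] at hA
  intro i
  have hy : 0 ≤ y i := h0 (Sum.inr i)
  have hi := congrFun hA i
  simp only [Pi.sub_apply] at hi
  linarith

/-- (11.2) and its standard form (11.3) have the same solutions: `x` is a global solution of the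
alternative-form problem iff `x̂` is a global solution of (11.3).
[cite: AntoniouLu2007, §11.2.1 (11.2)-(11.3)] -/
theorem altOptimal_iff_hatOptimal [DecidableEq p] (A : Matrix p n 𝕜) (b : p → 𝕜) (c x : n → 𝕜) :
    AltOptimal A b c x ↔ StdOptimal (hatA A) b (hatC c) (hatX A b x) := by
  constructor
  · rintro ⟨hx, hopt⟩
    refine ⟨stdFeasible_hatX hx, fun w hw => ?_⟩
    rw [hatC_dotProduct_hatX, sumElim_blocks w, hatC_dotProduct]
    rw [sumElim_blocks w] at hw
    exact hopt _ (altFeasible_of_stdFeasible_hat hw)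
  · rintro ⟨hfeas, hopt⟩
    have hx : AltFeasible A b x := by
      have := altFeasible_of_stdFeasible_hat (u := x⁺) (v := x⁻) (y := A *ᵥ x - b) hfeas
      rwa [posPart_sub_negPart] at this
    refine ⟨hx, fun x' hx' => ?_⟩
    have := hopt _ (stdFeasible_hatX hx')
    rwa [hatC_dotProduct_hatX, hatC_dotProduct_hatX] at this

/-! ### Example 11.1 -/

/-- **Example 11.1:** `minimize x₁ + 4x₂ subject to x₁ + x₂ = 1, x ≥ 0`; at `x* = (1, 0)ᵀ`,
(11.5d) gives `μ₁* = 0` and (11.5c) holds with `λ* = 1`, `μ₂* = 3`: the KKT conditions (11.5) are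
satisfied. [cite: AntoniouLu2007, §11.2.2 Example 11.1 (11.7)] -/
theorem example_11_1_kkt :
    StdKKT (𝕜 := ℚ) !![1, 1] ![1] ![1, 4] ![1, 0] ![1] ![0, 3] := by
  refine ⟨?_, ?_, ?_, ?_, ?_⟩
  · funext i
    fin_cases i
    simp [mulVec, dotProduct, Fin.sum_univ_two]
  · intro i
    fin_cases i <;> simp
  · intro i
    fin_cases i <;> simp
  · funext i
    fin_cases i <;> norm_num
  · intro i
    fin_cases i <;> simp

/-- **Example 11.1, conclusion:** "`x* = (1, 0)ᵀ` is indeed a global solution" — by Theorem 11.1.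
[cite: AntoniouLu2007, §11.2.2 Example 11.1] -/
theorem example_11_1_optimal : StdOptimal (𝕜 := ℚ) !![1, 1] ![1] ![1, 4] ![1, 0] :=
  stdOptimal_of_kkt example_11_1_kkt

end Literature.Analysis.Convex.LPOptimalityConditions
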